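import Literature.AnabelianGeometry.EtaleTheta.ConstantMultipleRigiditySub
import Literature.AnabelianGeometry.EtaleTheta.Discharge.Sec1Def17Coverings
import Literature.AnabelianGeometry.EtaleTheta.ThetaCohomologyInfRes
import Literature.AnabelianGeometry.EtaleTheta.ContH1Lemmas
import Literature.AnabelianGeometry.EtaleTheta.ContH1ConjAction
import HarnessLib

/-!
# [EtTh] Thm. 1.10 (i), sub-DAG row T110.i.r8 (V2′): `Π^tp_Ẋ`-equivariance of the unit Kummer classes
# — DISCHARGE of `Thm110UnitClassEquivariance` from [EtTh] Prop. 1.5 (ii) alone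

S. Mochizuki, *The étale theta function and its Frobenioid-theoretic manifestations*, Publ. RIMS **45**
(2009), §1: Prop. 1.5 (ii), PRIMS PDF p. 23 (printed 249) «`F̈² = H¹(G_K̈, Δ_Θ) →̃ (K̈^×)^∧`»; Def. 1.7
(I), p. 27 «`K = K̈`»; Thm. 1.10 (ii), p. 30 «we regard `K^× ⊆ (K^×)^∧ … = H¹(G_K, Δ_Θ)`»
[cite: MochizukiEtTh2009, Prop 1.5 (ii) p.23]. Cell abc-iut, layer L2, sub-DAG
`plan/L2/SUBDAG-EtTh-Thm110.md` row T110.i.r8 (V2′) — ROW «K2 / V2′» ruled to this seat by abc-iut-L2-lead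
(2026-08-26T02:35:13Z); seat abc-iut-w5-d234 (gen 2). PROOF-ONLY companion (0 definitions, no named fact
introduced) of `ConstantMultipleRigiditySub.lean` (abc-iut-w5-d140, p417168).

## What is proved

The typed intermediate statement `Thm110UnitClassEquivariance hC εZ E` (V2′) says: for every `σ ∈ Π^tp_X`
lying over `Π^tp_Ẋ` and every unit `u ∈ O^×_K̈`, conjugation by `σ` fixes the inflated Kummer class
`infl κ̈(u) ∈ H¹(Π^tp_Ÿ, Δ_Θ)`. The §1 interface proves this only for `σ ∈ Π^tp_Y`
(`KummerData.conj_inflTheta_kumYdd_eq_self`, abc-iut-L2-t1). Here it is DERIVED, for EVERY `σ ∈ Π^tp_X`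
(the restriction to `Π^tp_Ẋ` is not needed), from the single printed input [EtTh] Prop. 1.5 (ii)
«`F̈² = Im((K̈^×)^∧ ↪ H¹((Π^tp_Ÿ)^Θ, Δ_Θ))`» (`ThetaSetting.Prop15ii.Fdd2_eq`, FACT-LIST F-2503, taken BY NAME),
by the printed reason (Thm. 1.10 (ii), p. 30): `Π^tp_X` acts on `F̈² = H¹(G_K̈, Δ_Θ)` THROUGH `G_K̈`
(for a `MuTwoSetting`, `K = K̈` is condition (I) of Def. 1.7, a FIELD `sqrtqX_mem_K` — so no hypothesis),
and a group acts trivially, by inner automorphisms, on its own first cohomology.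

The proof is elementary continuous group cohomology over abc-iut-L2-t1's concrete `ContH1`:

* `ContH1.cocycle_apply_eq_one_of_res_eq_one` — a cocycle whose CLASS restricts to `1` on a subgroup
  `N` acting trivially on the coefficients VANISHES on `N` (a coboundary `n ↦ (n·a)·a⁻¹` is `1` there);
* `ContH1.conj_eq_self_of_res_eq_one` — **generic engine**: if `g ∈ G` centralises the coefficients
  `A` (through `φ`) and centralises `H` modulo `N` (`h⁻¹g⁻¹hg ∈ N` for `h ∈ H`), then `conj g` fixes
  every class of `H¹(H, A)` that restricts to `1` on `N` — at the cocycle level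
  `(g·f)(h) = f(g⁻¹hg) = f(h · n) = f(h)·(h·f(n)) = f(h)`; this is the degree-one shadow of «the action of
  `G` on `H¹(H/N, A^N)` factors through `G → Out(H/N) × Aut(A)`» and complements t1's
  `ContH1.conj_eq_self_of_mem` (inner automorphisms of `H` itself);
* `ThetaSetting.conj_inflTheta_eq_self_of_mem_deltaTemp` — every `δ ∈ Δ^tp_X` fixes `infl(x')` for
  `x' ∈ F̈²`: `θ(δ) ∈ (Δ^tp_X)^Θ` centralises `Δ_Θ` (root axiom `ker_thetaToEll_central`, «central
  extension», p. 12, via abc-iut-L2-t12's `conjNormal_eq_of_mem_map_deltaTemp`), `[Π^tp_Ÿ, δ] ⊆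
  Π^tp_Ÿ ∩ Δ^tp_X = Δ^tp_Ÿ`, and `infl(x')` restricts to `1` on `Δ^tp_Ÿ` because `x' ∈ F̈² =
  Ker(res → (Δ^tp_Ÿ)^Θ)` (inflation commutes with restriction, `ContH1.infl_res`);
* `ThetaSetting.conj_inflTheta_eq_self_of_mem_Fdd2` — hence every `σ ∈ Π^tp_X` with
  `aug(σ) ∈ aug(Π^tp_Ÿ)` fixes `infl(F̈²)`: `σ = τ·δ`, `τ ∈ Π^tp_Ÿ` (inner on `H¹(Π^tp_Ÿ, Δ_Θ)`,
  t1's `conj_eq_self_of_mem`), `δ ∈ Δ^tp_X`; and `…_of_aug_mem_GKdd` — the same under the print-faithful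
  hypothesis «`σ` acts on `K̄` through `G_K̈`» (`aug(Π^tp_Ÿ) = G_K̈` from the root field `map_aug_GtpYN`);
* `MuTwoSetting.aug_mem_map_aug_GtpYdd` — for a `MuTwoSetting` (condition (I) `K = K̈`),
  `aug(σ) ∈ G_K = G_K̈ = aug(Π^tp_Ÿ)` for EVERY `σ ∈ Π^tp_X` (abc-iut-L2-t1's `GtpYdd_eq_GtpYN_two`,
  `GKN_two_eq_GK`);
* **`thm110UnitClassEquivariance_of_prop15ii : Prop15ii E hC → Thm110UnitClassEquivariance hC εZ E`**
  — the row, closed modulo the ONE named fact; and the hypothesis-minimal form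
  `MuTwoSetting.conj_inflTheta_kumYdd_eq_self` (`κ̈(u) ∈ F̈²` for the given `u` suffices).

Why a fact is NEEDED (honest note, not a gap): the `KummerData` interface constrains `kumYdd` only by
injectivity and compatibility with `kumY`/`log(U)`; a class outside `F̈²` (e.g. `log(Ü)`, moved by the
`Z`-translates, Prop. 1.5 (iii)) is NOT fixed by `σ ∉ Π^tp_Y`, so V2′ does not follow from the interface
without the printed identification `F̈² = (K̈^×)^∧` of Prop. 1.5 (ii). Consumer of record:
`MuTwoSetting.thm110iUnique_of_formula` / `…_of_formulaSigned` (abc-iut-w5-d140, p417351).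
HONEST FRAMING: [EtTh] is refereed and undisputed; this is OUR kernel check of one step; typed ≠ proved
for the rest of Thm. 1.10; nothing here bears on the disputed [IUTchIII] Cor. 3.12.
-/

noncomputable section

namespace Literature.AnabelianGeometry.EtaleTheta

open Literature.AnabelianGeometry.SemiGraphs
open scoped IsMulCommutative

variable {p : ℕ} [Fact p.Prime]

/-! ### Generic engine: conjugation by an element centralising the coefficients and the group modulo
`N` fixes the classes that die on `N` -/

namespace ContH1

variable {G G' : Type*} [Group G] [TopologicalSpace G] [IsTopologicalGroup G]
  [Group G'] [TopologicalSpace G'] [IsTopologicalGroup G']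
  {φ : G →* G'} {A : Subgroup G'} [A.Normal] [IsMulCommutative A] {H : Subgroup G}

omit [IsTopologicalGroup G] in
/-- A continuous cocycle on `H` whose class restricts to `1` on a subgroup `N ≤ H` that acts TRIVIALLY on
the coefficients vanishes identically on `N` (on `N` it is a coboundary `n ↦ (n·a)·a⁻¹ = a·a⁻¹ = 1`).
[cite: NeukirchSchmidtWingberg2008, I §5] -/
theorem cocycle_apply_eq_one_of_res_eq_one {N : Subgroup G} (hNH : N ≤ H)
    (htriv : ∀ n ∈ N, ∀ a : A, MulAut.conjNormal (φ n) a = a)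
    (f : contCocycles φ A H) (hf : res φ A hNH (QuotientGroup.mk f : ContH1 φ A H) = 1)
    (n : H) (hn : (n : G) ∈ N) : f.1 n = 1 := by
  have h1 : (QuotientGroup.mk (resCocycle φ A hNH f) : ContH1 φ A N) = 1 := hf
  rw [QuotientGroup.eq_one_iff, Subgroup.mem_subgroupOf, mem_contCoboundaries_iff] at h1
  obtain ⟨a, ha⟩ := h1
  have h2 := congrFun ha ⟨(n : G), hn⟩
  rw [htriv _ hn a, mul_inv_cancel] at h2
  exact h2

/-- **Conjugation by an element that centralises the coefficients and centralises `H` modulo `N` fixes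
every class of `H¹(H, A)` that restricts to `1` on `N`.** For `g ∈ G` with `φ(g)` acting trivially on
`A` and `h⁻¹ g⁻¹ h g ∈ N` for all `h ∈ H` (`N ≤ H` acting trivially on `A`), and `x ∈ H¹(H, A)` with
`res_N x = 1`: `conj g x = x` — indeed already at the cocycle level, `(g·f)(h) = f(g⁻¹ h g) = f(h·n) =
f(h)·(h·f(n)) = f(h)`. (The degree-one case of: the `G`-action on the classes inflated from `H/N`
factors through the action on `H/N` and on `A`.) [cite: NeukirchSchmidtWingberg2008, I §5] -/
theorem conj_eq_self_of_res_eq_one [hN : H.Normal] {N : Subgroup G} (hNH : N ≤ H)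
    (htriv : ∀ n ∈ N, ∀ a : A, MulAut.conjNormal (φ n) a = a)
    {g : G} (hgA : ∀ a : A, MulAut.conjNormal (φ g) a = a)
    (hcomm : ∀ h ∈ H, h⁻¹ * g⁻¹ * h * g ∈ N)
    {x : ContH1 φ A H} (hx : res φ A hNH x = 1) : conj φ A g x = x := by
  induction x using QuotientGroup.induction_on with
  | H f =>
    rw [conj_mk]
    congr 1
    apply Subtype.ext
    funext h
    rw [conjCocycle_apply, hgA]
    have hn : (h : G)⁻¹ * g⁻¹ * h * g ∈ H := by
      have h1 : g⁻¹ * (h : G) * g⁻¹⁻¹ ∈ H := hN.conj_mem _ h.2 g⁻¹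
      rw [inv_inv] at h1
      have h2 := H.mul_mem (H.inv_mem h.2) h1
      simpa only [mul_assoc] using h2
    have e : MulAut.conjNormal g⁻¹ h = h * ⟨(h : G)⁻¹ * g⁻¹ * h * g, hn⟩ := by
      apply Subtype.ext
      simp only [MulAut.conjNormal_apply, inv_inv, Subgroup.coe_mul]
      group
    rw [e, f.2.2, cocycle_apply_eq_one_of_res_eq_one hNH htriv f hx ⟨(h : G)⁻¹ * g⁻¹ * h * g, hn⟩
      (hcomm h h.2), map_one, mul_one]

end ContH1

/-! ### The §1 model: `Π^tp_X` acts on `infl(F̈²) ⊆ H¹(Π^tp_Ÿ, Δ_Θ)` through `G_K/G_K̈` -/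

namespace ThetaSetting

variable {D : ThetaSetting p}

variable (D) in
/-- `Δ^tp_Ÿ ≤ Π^tp_Ÿ` (`Δ^tp_Ÿ := Π^tp_Ÿ ∩ Δ^tp_X`, p. 20). [cite: MochizukiEtTh2009, §1 p.17] -/
theorem DtpYddN_one_le_GtpYdd : D.DtpYddN 1 ≤ D.GtpYdd := inf_le_left

variable (D) in
/-- `(Δ^tp_Ÿ)^Θ ≤ (Π^tp_Ÿ)^Θ`. [cite: MochizukiEtTh2009, §1 p.17] -/
theorem map_toTheta_DtpYddN_one_le : (D.DtpYddN 1).map D.toTheta ≤ D.GtpYdd.map D.toTheta :=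
  Subgroup.map_mono D.DtpYddN_one_le_GtpYdd

/-- `infl(x')` restricts to `1` on `Δ^tp_Ÿ` for `x' ∈ F̈² = Ker(H¹((Π^tp_Ÿ)^Θ, Δ_Θ) → H¹((Δ^tp_Ÿ)^Θ, Δ_Θ))`
(inflation commutes with restriction). [cite: MochizukiEtTh2009, Prop 1.5 (ii) p.23] -/
theorem res_inflTheta_eq_one_of_mem_Fdd2 {x' : D.H1Theta (D.GtpYdd.map D.toTheta)}
    (hx' : x' ∈ (Fdd2 : Subgroup (D.H1Theta (D.GtpYdd.map D.toTheta)))) :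
    ContH1.res D.toTheta D.DeltaTheta D.DtpYddN_one_le_GtpYdd (D.inflTheta D.GtpYdd x') = 1 := by
  have hx1 : ContH1.res (MonoidHom.id D.GtpTheta) D.DeltaTheta D.map_toTheta_DtpYddN_one_le x' = 1 :=
    hx'
  have e := ContH1.infl_res (A := D.DeltaTheta) (hψ := D.continuous_toTheta) D.DtpYddN_one_le_GtpYdd
    D.map_toTheta_DtpYddN_one_le le_rfl le_rfl x'
  rw [hx1, map_one] at e
  exact e

/-- **Every `δ ∈ Δ^tp_X` fixes `infl(x')` for `x' ∈ F̈²`**: `θ(δ) ∈ (Δ^tp_X)^Θ` centralises `Δ_Θ` (root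
axiom «`Δ^Θ_X` is a central extension», p. 12), `h⁻¹δ⁻¹hδ ∈ Π^tp_Ÿ ∩ Δ^tp_X = Δ^tp_Ÿ` for `h ∈ Π^tp_Ÿ`
(`Π^tp_Ÿ ⊴ Π^tp_X`, `Δ^tp_X = Ker(aug)`), `Δ^tp_Ÿ` acts trivially on `Δ_Θ`, and `infl(x')` dies on `Δ^tp_Ÿ`.
[cite: MochizukiEtTh2009, Prop 1.5 (ii) p.23] -/
theorem conj_inflTheta_eq_self_of_mem_deltaTemp (hC : D.Compat) {δ : D.PiTemp}
    (hδ : δ ∈ D.DeltaTemp) {x' : D.H1Theta (D.GtpYdd.map D.toTheta)}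
    (hx' : x' ∈ (Fdd2 : Subgroup (D.H1Theta (D.GtpYdd.map D.toTheta)))) :
    haveI := hC.GtpYdd_normal
    ContH1.conj D.toTheta D.DeltaTheta δ (D.inflTheta D.GtpYdd x') = D.inflTheta D.GtpYdd x' := by
  haveI := hC.GtpYdd_normal
  have hδ1 : D.aug.toMonoidHom δ = 1 := hδ
  refine ContH1.conj_eq_self_of_res_eq_one D.DtpYddN_one_le_GtpYdd
    (fun n hn a => D.conjNormal_eq_of_mem_DtpYddTheta (D.toTheta n) ⟨n, hn, rfl⟩ a)
    (fun a => D.conjNormal_eq_of_mem_map_deltaTemp ⟨δ, hδ, rfl⟩ a) (fun h hh => ?_)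
    (res_inflTheta_eq_one_of_mem_Fdd2 hx')
  -- `h⁻¹ (δ⁻¹ h δ) ∈ Π^tp_Ÿ`
  have hmem : h⁻¹ * δ⁻¹ * h * δ ∈ D.GtpYdd := by
    have h1 : δ⁻¹ * h * δ⁻¹⁻¹ ∈ D.GtpYdd := hC.GtpYdd_normal.conj_mem _ hh δ⁻¹
    rw [inv_inv] at h1
    have h2 := D.GtpYdd.mul_mem (D.GtpYdd.inv_mem hh) h1
    simpa only [mul_assoc] using h2
  -- `aug(h⁻¹ δ⁻¹ h δ) = 1`
  have haug : h⁻¹ * δ⁻¹ * h * δ ∈ D.DeltaTemp := by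
    change D.aug.toMonoidHom (h⁻¹ * δ⁻¹ * h * δ) = 1
    rw [map_mul, map_mul, map_mul, map_inv, map_inv, hδ1, inv_one, mul_one, mul_one, inv_mul_cancel]
  exact Subgroup.mem_inf.2 ⟨hmem, haug⟩

/-- **Every `σ ∈ Π^tp_X` whose image in `G_K` is the image of an element of `Π^tp_Ÿ` fixes `infl(x')`
for `x' ∈ F̈²`** — `σ = τ·δ` with `τ ∈ Π^tp_Ÿ` acting innerly on `H¹(Π^tp_Ÿ, Δ_Θ)` (abc-iut-L2-t1's
`ContH1.conj_eq_self_of_mem`) and `δ ∈ Δ^tp_X` (`conj_inflTheta_eq_self_of_mem_deltaTemp`). Print: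
`Π^tp_X` acts on `F̈² = H¹(G_K̈, Δ_Θ)` through `G_K` (Thm. 1.10 (ii), p. 30).
[cite: MochizukiEtTh2009, Thm 1.10 (ii) p.30] -/
theorem conj_inflTheta_eq_self_of_mem_Fdd2 (hC : D.Compat) {σ : D.PiTemp}
    (hσ : D.aug.toMonoidHom σ ∈ D.GtpYdd.map D.aug.toMonoidHom)
    {x' : D.H1Theta (D.GtpYdd.map D.toTheta)}
    (hx' : x' ∈ (Fdd2 : Subgroup (D.H1Theta (D.GtpYdd.map D.toTheta)))) :
    haveI := hC.GtpYdd_normal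
    ContH1.conj D.toTheta D.DeltaTheta σ (D.inflTheta D.GtpYdd x') = D.inflTheta D.GtpYdd x' := by
  haveI := hC.GtpYdd_normal
  obtain ⟨τ, hτ, hτσ⟩ := hσ
  have hδ : τ⁻¹ * σ ∈ D.DeltaTemp := by
    change D.aug.toMonoidHom (τ⁻¹ * σ) = 1
    rw [map_mul, map_inv, hτσ, inv_mul_cancel]
  rw [show σ = τ * (τ⁻¹ * σ) from (mul_inv_cancel_left τ σ).symm, ContH1.conj_mul_apply,
    conj_inflTheta_eq_self_of_mem_deltaTemp hC hδ hx', ContH1.conj_eq_self_of_mem τ hτ]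

/-- `aug(Π^tp_Ÿ) = G_K̈` — for EVERY theta setting: `Π^tp_Ÿ = Π^tp_{Y₂} ∩ aug⁻¹(G_{J̈₁})`, `G_{J̈₁} = G_{K₂} =
G_K̈` (`GJddN_one`), and `aug(Π^tp_{Y₂}) = G_{K₂}` (root field `map_aug_GtpYN`).
[cite: MochizukiEtTh2009, §1 p.17] -/
theorem map_aug_GtpYdd_eq_GKdd : D.GtpYdd.map D.aug.toMonoidHom = D.GKdd := by
  apply le_antisymm
  · rintro _ ⟨τ, hτ, rfl⟩
    have h2 : τ ∈ (D.GJddN 1).comap D.aug.toMonoidHom := (Subgroup.mem_inf.1 hτ).2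
    rw [D.GJddN_one] at h2
    exact h2
  · intro γ hγ
    have hγ' : γ ∈ (D.GtpYN 2).map D.aug.toMonoidHom := by
      rw [D.map_aug_GtpYN 2]; exact hγ
    obtain ⟨τ, hτ, rfl⟩ := hγ'
    refine ⟨τ, Subgroup.mem_inf.2 ⟨?_, ?_⟩, rfl⟩
    · simpa using hτ
    · rw [Subgroup.mem_comap, D.GJddN_one]
      exact (D.map_aug_GtpYN 2).le ⟨τ, hτ, rfl⟩

/-- **Print-faithful form**: every `σ ∈ Π^tp_X` acting on `K̄` through `G_K̈` (`aug(σ) ∈ G_K̈`) fixes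
`infl(x')` for `x' ∈ F̈² = H¹(G_K̈, Δ_Θ)`. [cite: MochizukiEtTh2009, Thm 1.10 (ii) p.30] -/
theorem conj_inflTheta_eq_self_of_aug_mem_GKdd (hC : D.Compat) {σ : D.PiTemp}
    (hσ : D.aug.toMonoidHom σ ∈ D.GKdd) {x' : D.H1Theta (D.GtpYdd.map D.toTheta)}
    (hx' : x' ∈ (Fdd2 : Subgroup (D.H1Theta (D.GtpYdd.map D.toTheta)))) :
    haveI := hC.GtpYdd_normal
    ContH1.conj D.toTheta D.DeltaTheta σ (D.inflTheta D.GtpYdd x') = D.inflTheta D.GtpYdd x' :=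
  conj_inflTheta_eq_self_of_mem_Fdd2 hC (by rw [map_aug_GtpYdd_eq_GKdd]; exact hσ) hx'

namespace KummerData

variable (E : D.KummerData)

/-- **Under [EtTh] Prop. 1.5 (ii) (`F̈² = Im κ̈`, named fact `Prop15ii`), every `σ ∈ Π^tp_X` acting on `K̄`
through `G_K̈` fixes the inflated Kummer class `infl κ̈(w)` of every `w ∈ K̈^×`** — for all of `Π^tp_X`
when `K = K̈`; abc-iut-L2-t1's `conj_inflTheta_kumYdd_eq_self` is the case `σ ∈ Π^tp_Y`.
[cite: MochizukiEtTh2009, Prop 1.5 (ii) p.23] -/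
theorem conj_inflTheta_kumYdd_eq_self_of_aug_mem_GKdd (hC : D.Compat) (h15ii : Prop15ii E hC)
    {σ : D.PiTemp} (hσ : D.aug.toMonoidHom σ ∈ D.GKdd) (w : (↥D.Kdd)ˣ) :
    haveI := hC.GtpYdd_normal
    ContH1.conj D.toTheta D.DeltaTheta σ (D.inflTheta D.GtpYdd (E.kumYdd (E.toKddHat w))) =
      D.inflTheta D.GtpYdd (E.kumYdd (E.toKddHat w)) :=
  conj_inflTheta_eq_self_of_aug_mem_GKdd hC hσ (by rw [h15ii.Fdd2_eq]; exact ⟨_, rfl⟩)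

end KummerData

end ThetaSetting

/-! ### `MuTwoSetting` (condition (I) `K = K̈` is a field): the row V2′ -/

namespace MuTwoSetting

variable (M : MuTwoSetting p)

/-- For a `MuTwoSetting` (`K = K̈`, Def. 1.7 (I)): `aug(Π^tp_Ÿ) = G_K`.
[cite: MochizukiEtTh2009, Def 1.7 p.27] -/
theorem map_aug_GtpYdd_eq_GK : M.GtpYdd.map M.aug.toMonoidHom = M.GK := by
  rw [ThetaSetting.map_aug_GtpYdd_eq_GKdd]
  exact M.GKN_two_eq_GK

/-- For a `MuTwoSetting`, EVERY `σ ∈ Π^tp_X` has `aug(σ) ∈ G_K = aug(Π^tp_Ÿ)`.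
[cite: MochizukiEtTh2009, Def 1.7 p.27] -/
theorem aug_mem_map_aug_GtpYdd (σ : M.PiTemp) :
    M.aug.toMonoidHom σ ∈ M.GtpYdd.map M.aug.toMonoidHom := by
  rw [map_aug_GtpYdd_eq_GK]
  exact M.aug_mem_GK σ

/-- **Hypothesis-minimal form of V2′**: for a `MuTwoSetting`, every `σ ∈ Π^tp_X` fixes `infl κ̈(u)` as soon
as `κ̈(u) ∈ F̈²`. [cite: MochizukiEtTh2009, Thm 1.10 (ii) p.30] -/
theorem conj_inflTheta_kumYdd_eq_self (hC : M.toThetaSetting.Compat)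
    (E : M.toThetaSetting.KummerData) (σ : M.PiTemp) (u : (↥M.Kdd)ˣ)
    (hu : E.kumYdd (E.toKddHat u) ∈
      (ThetaSetting.Fdd2 : Subgroup (M.toThetaSetting.H1Theta (M.GtpYdd.map M.toTheta)))) :
    haveI := hC.GtpYdd_normal
    ContH1.conj M.toTheta M.toThetaSetting.DeltaTheta σ
        (M.toThetaSetting.inflTheta M.toThetaSetting.GtpYdd (E.kumYdd (E.toKddHat u))) =
      M.toThetaSetting.inflTheta M.toThetaSetting.GtpYdd (E.kumYdd (E.toKddHat u)) :=
  ThetaSetting.conj_inflTheta_eq_self_of_mem_Fdd2 hC (M.aug_mem_map_aug_GtpYdd σ) hu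

end MuTwoSetting

section Thm110Sub

variable {M : MuTwoSetting p}

/-- **Row T110.i.r8 (V2′) DISCHARGED modulo [EtTh] Prop. 1.5 (ii)**: for a `MuTwoSetting` (`K = K̈`),
`Prop15ii E hC` (`F̈² = Im κ̈`, FACT-LIST, BY NAME) implies `Thm110UnitClassEquivariance hC εZ E` — for every
choice of `ε_Z` (the restriction «`inclX σ ∈ Π^tp_Ẋ`» of the typed statement is not used: all of `Π^tp_X`
acts trivially). [cite: MochizukiEtTh2009, Thm 1.10 (ii) p.30] -/
theorem thm110UnitClassEquivariance_of_prop15ii (hC : M.toThetaSetting.Compat) (εZ : M.GtpC)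
    {E : M.toThetaSetting.KummerData} (h15ii : ThetaSetting.Prop15ii E hC) :
    Thm110UnitClassEquivariance hC εZ E := by
  intro σ _ u _
  exact M.conj_inflTheta_kumYdd_eq_self hC E σ u (by rw [h15ii.Fdd2_eq]; exact ⟨_, rfl⟩)

end Thm110Sub

end Literature.AnabelianGeometry.EtaleTheta

end
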